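import Mathlib
import Summits.Ventures.PercRepro2.HCov
import Summits.Ventures.PercRepro2.BHKOutside
import Summits.Ventures.PercRepro2.ISplit
import Summits.Ventures.PercRepro2.CovFourTerm
import Summits.Ventures.PercRepro2.FirstOrderTerms
import Summits.Ventures.PercRepro2.PendantK1

/-!
# `(K1)` is a theorem (blind cell PercRepro2, p5 g22; `proofs/P5-OEDGE.md` §28 addendum 1, `S4-HARDSTEP.md` v95)

The first half of the pendant-root condition `(K)` of §27 addendum 3 (`2′PROOT ⟸ (HCOV) ∧ (K)`),

  `(K1)`: `D · C(γ) ≥ Q · D₀ · (γ − γ₀) · P(PD, b ∈ C₂)`, cleared **`Q·(D₀·D_o − D·D_o⁰)·P(PD, b ∈ C₂) ≤ D · Cc`**,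

holds on every instance: `PendantK1.K1_of_T_dominates_PD` (the ratio argument through `Cc ≥ 0`, `Cfo ≥ 0`
and Harris) applied with the domination `P(b ∈ C₂ | T) ≥ P(b ∈ C₂ | PD)`, which is proved here inline
(it is `PendantDomination.T_bH_dominates_PD`; re-derived in this file so that the composition does not
wait for that module's object file): with `R = {a₁ ↮ a₂, a₃} = PD ⊔ T`, the events `a₃ ∈ C₂` and `b ∈ C₂`
are increasing events of the cluster of `a₂` off `C₁`, positively correlated conditionally on `R`
(`bhk_two_outside_avoid`, `s = a₁`, `u = v = a₂`, `X = {a₂, a₃}`):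
`P(R, a₃ ∈ C₂) · P(R, b ∈ C₂) ≤ P(R, a₃ ∈ C₂, b ∈ C₂) · P(R)`, i.e. `P(T) · P(R, b ∈ C₂) ≤ P(T, b ∈ C₂) · P(R)`.
What remains of `(K)` is its second half `(K2)` together with the surplus of `(K1)`: in the regime `γ > γ₀`
this is `W ≥ 0`, in the regime `γ ≤ γ₀` it is `D·Φ/D₀ ≥ (γ₀ − γ)·W`.
-/

namespace Summit.Ventures.PercRepro2

open UnionCluster

namespace CovForm

namespace FirstOrder

variable {V : Type*} {E : Type*} [Fintype E] [DecidableEq E] [Fintype V] [DecidableEq V]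
  {R : Type*} [Field R] [LinearOrder R] [IsStrictOrderedRing R]

/-- **`(K1)` unconditionally**: `Q · (D₀ · D_o − D · D_o⁰) · P(PD, b ∈ C₂) ≤ D · Cc` on every instance. -/
theorem K1 (p : E → R) (hp : IsProbVec p) (ends : E → Sym2 V) (o a₁ a₂ a₃ b : V) :
    prob p (avoidAll ends a₂ {a₁}) *
        (D0 p ends a₁ a₃ * Do p ends o a₁ a₂ a₃ - prob p (PDEvent ends a₁ a₂ a₃) * Do0 p ends o a₁ a₃) *
        prob p (PDEvent ends a₁ a₂ a₃ ∩ connEvent ends a₂ b) ≤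
      prob p (PDEvent ends a₁ a₂ a₃) * FourTerm.Cc p ends o a₁ a₂ a₃ b := by
  classical
  apply K1_of_T_dominates_PD p hp ends o a₁ a₂ a₃ b
  -- the domination `P(T) · P(PD, b ∈ C₂) ≤ P(PD) · P(T, b ∈ C₂)`
  have e1 : clusterInEvent ends a₂ {W | a₃ ∈ W} ∩ avoidAll ends a₁ {a₂, a₃} = TEvent ends a₁ a₂ a₃ := by
    ext ω
    simp only [TEvent, Set.mem_inter_iff, Set.mem_compl_iff, mem_connEvent, mem_clusterInEvent,
      Set.mem_setOf_eq, mem_cluster, mem_avoidAll, Finset.mem_insert, Finset.mem_singleton,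
      forall_eq_or_imp, forall_eq]
    constructor
    · rintro ⟨h23, h12, _⟩
      exact ⟨fun h21 => h12 (conn_symm h21), h23⟩
    · rintro ⟨h21, h23⟩
      exact ⟨h23, fun h12 => h21 (conn_symm h12),
        fun h13 => h21 (conn_symm (conn_trans h13 (conn_symm h23)))⟩
  have e2 : clusterInEvent ends a₂ {W | a₃ ∈ W} ∩ clusterInEvent ends a₂ {W | b ∈ W} ∩
      avoidAll ends a₁ {a₂, a₃} = TEvent ends a₁ a₂ a₃ ∩ connEvent ends a₂ b := by
    rw [Set.inter_assoc, Set.inter_comm (clusterInEvent ends a₂ {W | b ∈ W}), ← Set.inter_assoc, e1,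
      ← connEvent_eq_clusterInEvent]
  have h := bhk_two_outside_avoid p hp ends a₁ a₂ a₂ ({a₂, a₃} : Finset V)
    (isUpperSet_mem_setOf a₃) (isUpperSet_mem_setOf b)
  have hins : insert a₂ ({a₂, a₃} : Finset V) = {a₂, a₃} :=
    Finset.insert_eq_of_mem (Finset.mem_insert_self a₂ {a₃})
  rw [hins, hins, e1, e2, ← connEvent_eq_clusterInEvent ends a₂ b] at h
  have hR := ISplit.prob_PD_add_T p ends a₁ a₂ a₃ Set.univ
  simp only [Set.inter_univ] at hR
  have hb := ISplit.prob_PD_add_T p ends a₁ a₂ a₃ (connEvent ends a₂ b)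
  rw [Set.inter_comm (connEvent ends a₂ b), ← hb, ← hR] at h
  nlinarith [h]

end FirstOrder

end CovForm

end Summit.Ventures.PercRepro2
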